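import Mathlib.Data.Complex.Basic
import Mathlib.FieldTheory.IntermediateField.Adjoin.Algebra
import Literature.RingTheory.KrullDimension.FibreDimension
import HarnessLib

/-!
# Horizontal weak Zilber–Pink, step 3: the generic-fibre certificate for a parametrised point

Support file for the uniform horizontal weak Zilber–Pink theorem (Bays–Kirby 2018, Thm 11.4 /
Fact 11.3; Kirby 2009, Thm 4.6). In the compactness (ultraproduct) step the members `V_{b_k}` of an
algebraic family vary with `k`; the one-field Schanuel bound (`WeakZP.exists_int_relation_rel`)
then needs, for the ultraproduct `(b*, u*, y*)` of the parameters and of the generic points of the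
atypical components `X_k ⊆ V_{b_k}`, the bound

  `trdeg_{ℂ(b*)} ℂ(b*)[u*, y*] ≤ d`    (`d = dim V_{b_k}` for almost all `k`).

This file proves the purely algebraic statement behind it, for an arbitrary field `E ⊇ ℂ` and a
point `pt = (b*, w*) ∈ E^{p ⊕ σ}` (`WeakZP.exists_generic_fibre_certificate`): with `𝔔 = I(pt/ℂ)`,
`𝔭 = I(b*/ℂ)`, `A = ℂ[b] ⧸ 𝔭 ⊆ B = ℂ[b, w] ⧸ 𝔔` (so `b*` is a generic point of the "limit
variety of the parameters" and `pt` one of the total space), the theorem on the dimension of the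
generic fibres (`Literature.RingTheory.KrullDimension.exists_ringKrullDim_quotient_eq_of_mem_minimalPrimes`:
`f ≠ 0` in `A`, `dim A = e`, `dim B = e + r`, all components of the fibres over closed points of
`D(f)` have dimension `r`) gives

1. `trdeg_{ℂ(b*)} ℂ(b*)[w*] ≤ r` (transcendence bases of `ℂ(b*)/ℂ` and of `ℂ(b*)[w*]/ℂ(b*)`
   concatenate to a `ℂ`-algebraically independent family in `ℂ[pt] ≅ B`), and
2. a **specialisation criterion** for `r ≤ d`: if some complex parameter `b₀` has `f(b₀) ≠ 0`,
   kills generators of `𝔭`, and the specialisations `g(b₀, ·)` of generators of `𝔔` lie in a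
   prime `P₀ ⊆ ℂ[w]` every prime `𝔮 ⊆ P₀` containing the specialised defining polynomials
   having `dim ℂ[w] ⧸ 𝔮 ≤ d`, then `r ≤ d` (the fibre of `Spec B → Spec A` over `b₀` has a
   component inside `P₀`, of dimension `r`).

In the application the three conditions on `b₀ = b_k` hold for almost all `k` by Łoś, and the
dimension hypothesis is the (eventually constant) dimension of the family members.

## References

* M. Bays, J. Kirby, *Pseudo-exponential maps, variants, and quasiminimality*, ANT 12 (2018),
  Thm 11.4 (proof: "by the definability of dimension").
* T. A. Springer, *Linear Algebraic Groups*, 2nd ed. (1998), Thm 5.1.6 (ii).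
-/

noncomputable section

open MvPolynomial Set Cardinal

namespace Literature.NumberTheory.Transcendental.WeakZP

variable {E : Type} [Field E] [Algebra ℂ E] {p : ℕ} {σ : Type} [Fintype σ]

/-- The specialisation of the parameters at a complex point: `g ↦ g(b₀, ·)`,
`ℂ[b, w] → ℂ[w]`. [folklore] -/
def spec (b₀ : Fin p → ℂ) : MvPolynomial (Fin p ⊕ σ) ℂ →ₐ[ℂ] MvPolynomial σ ℂ :=
  aeval (Sum.elim (fun l => C (b₀ l)) X)

omit [Fintype σ] in
/-- `spec` on parameter variables. [folklore] -/
@[simp] theorem spec_X_inl (b₀ : Fin p → ℂ) (l : Fin p) :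
    spec (σ := σ) b₀ (X (Sum.inl l)) = C (b₀ l) := by
  rw [spec, aeval_X, Sum.elim_inl]

omit [Fintype σ] in
/-- `spec` on space variables. [folklore] -/
@[simp] theorem spec_X_inr (b₀ : Fin p → ℂ) (c : σ) : spec b₀ (X (Sum.inr c)) = X c := by
  rw [spec, aeval_X, Sum.elim_inr]

omit [Fintype σ] in
/-- Evaluating a specialisation: `g(b₀, ·)(v) = g(b₀, v)`. [folklore] -/
theorem aeval_spec {S : Type*} [CommRing S] [Algebra ℂ S] (b₀ : Fin p → ℂ) (v : σ → S)
    (g : MvPolynomial (Fin p ⊕ σ) ℂ) :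
    aeval v (spec b₀ g) = aeval (Sum.elim (fun l => algebraMap ℂ S (b₀ l)) v) g := by
  have : (fun i => aeval v (Sum.elim (fun l => C (b₀ l)) X i)) =
      Sum.elim (fun l => algebraMap ℂ S (b₀ l)) v := by
    funext c; rcases c with l | c <;> simp
  rw [spec, ← AlgHom.comp_apply, comp_aeval, this]

/-- `trdeg` of an affine domain of dimension `n` is `n`. [cite: Matsumura1987, Thm 5.6] -/
theorem trdeg_eq_of_ringKrullDim_eq {A : Type} [CommRing A] [IsDomain A] [Algebra ℂ A]
    [Algebra.FiniteType ℂ A] {n : ℕ} (h : ringKrullDim A = n) : Algebra.trdeg ℂ A = n := by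
  rw [Literature.RingTheory.KrullDimension.ringKrullDim_eq_trdeg ℂ A] at h
  have h1 : Cardinal.toNat (Algebra.trdeg ℂ A) = n := by exact_mod_cast h
  rw [Literature.RingTheory.KrullDimension.trdeg_eq_toNat ℂ A, h1]

/-- `ℂ[z] ≅ ℂ[Z] ⧸ I(z/ℂ)`: the `trdeg` of the subalgebra generated by a point is that of the
quotient by its ideal. [folklore] -/
theorem trdeg_adjoin_range_eq {τ : Type} (z : τ → E) :
    Algebra.trdeg ℂ (Algebra.adjoin ℂ (Set.range z)) =
      Algebra.trdeg ℂ (MvPolynomial τ ℂ ⧸ RingHom.ker (aeval z : MvPolynomial τ ℂ →ₐ[ℂ] E)) := by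
  set φ := (aeval z : MvPolynomial τ ℂ →ₐ[ℂ] E) with hφ
  have e : (MvPolynomial τ ℂ ⧸ RingHom.ker φ) ≃ₐ[ℂ] φ.range :=
    (Ideal.quotientEquivAlgOfEq ℂ (AlgHom.ker_rangeRestrict φ).symm).trans
      (Ideal.quotientKerAlgEquivOfSurjective (AlgHom.rangeRestrict_surjective φ))
  rw [Algebra.adjoin_range_eq_range_aeval, ← hφ, e.trdeg_eq]

open scoped IntermediateField.algebraAdjoinAdjoin in
/-- **The generic-fibre certificate** (see the module docstring). [cite: BaysKirby2018ANT, Thm 11.4 (proof)] -/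
theorem exists_generic_fibre_certificate [CharZero E] (pt : Fin p ⊕ σ → E)
    (Φ : Finset (MvPolynomial (Fin p ⊕ σ) ℂ)) (hΦ : ∀ φ ∈ Φ, aeval pt φ = 0) :
    ∃ (f₀ : MvPolynomial (Fin p) ℂ) (G : Finset (MvPolynomial (Fin p ⊕ σ) ℂ))
      (G' : Finset (MvPolynomial (Fin p) ℂ)) (r : ℕ),
      aeval (pt ∘ Sum.inl) f₀ ≠ 0 ∧ (∀ g ∈ G, aeval pt g = 0) ∧
      (∀ g ∈ G', aeval (pt ∘ Sum.inl) g = 0) ∧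
      Algebra.trdeg (IntermediateField.adjoin ℂ (Set.range (pt ∘ Sum.inl)))
        (Algebra.adjoin (IntermediateField.adjoin ℂ (Set.range (pt ∘ Sum.inl)))
          (Set.range (pt ∘ Sum.inr))) ≤ r ∧
      ∀ (b₀ : Fin p → ℂ) (P₀ : Ideal (MvPolynomial σ ℂ)), P₀.IsPrime →
        aeval b₀ f₀ ≠ 0 → (∀ g ∈ G, spec b₀ g ∈ P₀) → (∀ g ∈ G', aeval b₀ g = 0) →
        ∀ d : ℕ, (∀ 𝔮 : Ideal (MvPolynomial σ ℂ), 𝔮.IsPrime → 𝔮 ≤ P₀ →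
          (∀ φ ∈ Φ, spec b₀ φ ∈ 𝔮) → ringKrullDim (MvPolynomial σ ℂ ⧸ 𝔮) ≤ d) → r ≤ d := by
  classical
  -- the rings `A = ℂ[b] ⧸ 𝔭 ⊆ B = ℂ[b, w] ⧸ 𝔔`
  set bs : Fin p → E := pt ∘ Sum.inl with hbs
  set A₀ := MvPolynomial (Fin p) ℂ with hA₀
  set 𝔔 : Ideal (MvPolynomial (Fin p ⊕ σ) ℂ) := RingHom.ker (aeval pt : MvPolynomial (Fin p ⊕ σ) ℂ →ₐ[ℂ] E) with h𝔔
  set 𝔭 : Ideal A₀ := RingHom.ker (aeval bs : A₀ →ₐ[ℂ] E) with h𝔭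
  haveI h𝔔p : 𝔔.IsPrime := RingHom.ker_isPrime _
  haveI h𝔭p : 𝔭.IsPrime := RingHom.ker_isPrime _
  let ι₀ : A₀ →ₐ[ℂ] MvPolynomial (Fin p ⊕ σ) ℂ := rename Sum.inl
  have hι₀ : ∀ g : A₀, aeval pt (ι₀ g) = aeval bs g := fun g => by
    rw [aeval_rename]
  have h𝔭𝔔 : 𝔭 = 𝔔.comap ι₀ := by
    ext g
    rw [Ideal.mem_comap, RingHom.mem_ker, RingHom.mem_ker]
    show aeval bs g = 0 ↔ aeval pt (ι₀ g) = 0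
    rw [hι₀]
  set A := A₀ ⧸ 𝔭 with hA
  set B := MvPolynomial (Fin p ⊕ σ) ℂ ⧸ 𝔔 with hB
  haveI : IsDomain A := Ideal.Quotient.isDomain 𝔭
  haveI : IsDomain B := Ideal.Quotient.isDomain 𝔔
  let φAB : A →ₐ[ℂ] B := Ideal.quotientMapₐ 𝔔 ι₀ h𝔭𝔔.le
  have hφAB : Function.Injective φAB := Ideal.quotientMap_injective' (H := h𝔭𝔔.le) h𝔭𝔔.ge
  letI : Algebra A B := φAB.toRingHom.toAlgebra
  haveI : IsScalarTower ℂ A B := IsScalarTower.of_algebraMap_eq fun c => (φAB.commutes c).symm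
  haveI : FaithfulSMul A B := (faithfulSMul_iff_algebraMap_injective A B).2 hφAB
  haveI : Algebra.FiniteType ℂ A :=
    Algebra.FiniteType.of_surjective (Ideal.Quotient.mkₐ ℂ 𝔭) Ideal.Quotient.mk_surjective
  haveI : Algebra.FiniteType ℂ B :=
    Algebra.FiniteType.of_surjective (Ideal.Quotient.mkₐ ℂ 𝔔) Ideal.Quotient.mk_surjective
  obtain ⟨f, e, r, hf0, hdimA, hdimB, hfib⟩ :=
    Literature.RingTheory.KrullDimension.exists_ringKrullDim_quotient_eq_of_mem_minimalPrimes ℂ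
      (A := A) (B := B)
  obtain ⟨f₀, rfl⟩ := Ideal.Quotient.mk_surjective f
  have hf₀ : f₀ ∉ 𝔭 := fun h => hf0 (Ideal.Quotient.eq_zero_iff_mem.2 h)
  obtain ⟨G, hG⟩ := (isNoetherian_def.1 (inferInstance : IsNoetherian (MvPolynomial (Fin p ⊕ σ) ℂ) (MvPolynomial (Fin p ⊕ σ) ℂ))) 𝔔
  obtain ⟨G', hG'⟩ := (isNoetherian_def.1 (inferInstance : IsNoetherian A₀ A₀)) 𝔭
  have hGmem : ∀ g ∈ G, g ∈ 𝔔 := fun g hg => hG ▸ Ideal.subset_span hg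
  have hG'mem : ∀ g ∈ G', g ∈ 𝔭 := fun g hg => hG' ▸ Ideal.subset_span hg
  refine ⟨f₀, G, G', r, hf₀, fun g hg => hGmem g hg, fun g hg => hG'mem g hg, ?_, ?_⟩
  · /- (1) `trdeg_{ℂ(b)} ℂ(b)[w] ≤ r` -/
    set k₁ : IntermediateField ℂ E := IntermediateField.adjoin ℂ (Set.range bs) with hk₁
    set Aimg : Subalgebra ℂ E := Algebra.adjoin ℂ (Set.range bs) with hAimg
    set Bimg : Subalgebra ℂ E := Algebra.adjoin ℂ (Set.range pt) with hBimg
    set A' : Subalgebra k₁ E := Algebra.adjoin k₁ (Set.range (pt ∘ Sum.inr)) with hA'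
    -- `trdeg ℂ Aimg = e`, `trdeg ℂ Bimg = e + r`
    have htA : Algebra.trdeg ℂ Aimg = e := by
      rw [hAimg, trdeg_adjoin_range_eq, ← h𝔭]
      exact trdeg_eq_of_ringKrullDim_eq hdimA
    have htB : Algebra.trdeg ℂ Bimg = (e + r : ℕ) := by
      rw [hBimg, trdeg_adjoin_range_eq, ← h𝔔]
      exact trdeg_eq_of_ringKrullDim_eq hdimB
    -- a transcendence basis `s` of `Aimg/ℂ`
    haveI : FaithfulSMul ℂ Aimg := (faithfulSMul_iff_algebraMap_injective ℂ Aimg).2 (algebraMap ℂ Aimg).injective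
    obtain ⟨s, hs⟩ := exists_isTranscendenceBasis ℂ Aimg
    have hscard : #s = e := by rw [hs.cardinalMk_eq_trdeg, htA]
    -- a transcendence basis `t` of `A'/k₁` inside the generators
    set gens : Set A' := ((↑) : A' → E) ⁻¹' Set.range (pt ∘ Sum.inr) with hgens
    have hgtop : Algebra.adjoin k₁ gens = ⊤ := by
      apply Subalgebra.map_injective (f := A'.val) Subtype.val_injective
      rw [AlgHom.map_adjoin, Algebra.map_top, Subalgebra.range_val]
      have hr : Set.range ((↑) : A' → E) = (A' : Set E) := Subtype.range_coe
      have himg : (A'.val : A' → E) '' gens = Set.range (pt ∘ Sum.inr) := by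
        rw [Subalgebra.coe_val, hgens, Set.image_preimage_eq_inter_range, hr, Set.inter_eq_left.mpr]
        exact Algebra.subset_adjoin
      rw [himg]
    haveI : Algebra.IsAlgebraic (Algebra.adjoin k₁ gens) A' :=
      ⟨fun b => isAlgebraic_algebraMap (⟨b, by rw [hgtop]; exact Algebra.mem_top⟩ : Algebra.adjoin k₁ gens)⟩
    obtain ⟨t, -, htg, ht⟩ := exists_isTranscendenceBasis_between (R := k₁) (A := A') ∅ gens
      (Set.empty_subset _) ((algebraicIndependent_empty_iff k₁ A').mpr (algebraMap k₁ A').injective)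
    have htcard : #t = Algebra.trdeg k₁ A' := ht.cardinalMk_eq_trdeg
    -- the concatenated family is `ℂ`-algebraically independent
    have hsF : AlgebraicIndependent ℂ (Aimg.val ∘ ((↑) : s → Aimg)) := hs.1.map' Subtype.val_injective
    have htF : AlgebraicIndependent k₁ (A'.val ∘ ((↑) : t → A')) := ht.1.map' Subtype.val_injective
    have hsk₁ : Set.range (Aimg.val ∘ ((↑) : s → Aimg)) ⊆ Set.range (algebraMap k₁ E) := by
      rintro _ ⟨a, rfl⟩
      have : ((a : Aimg) : E) ∈ k₁ := IntermediateField.algebra_adjoin_le_adjoin ℂ _ (a : Aimg).2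
      exact ⟨⟨_, this⟩, rfl⟩
    have hsum : AlgebraicIndependent ℂ (Sum.elim (A'.val ∘ ((↑) : t → A')) (Aimg.val ∘ ((↑) : s → Aimg))) :=
      hsF.sumElim_of_tower hsk₁ htF
    -- it lies in `Bimg`
    have hAB' : Aimg ≤ Bimg := Algebra.adjoin_mono fun _ ⟨l, hl⟩ => ⟨Sum.inl l, hl⟩
    have hmemB : ∀ i, Sum.elim (A'.val ∘ ((↑) : t → A')) (Aimg.val ∘ ((↑) : s → Aimg)) i ∈ Bimg := by
      rintro (a | a)
      · obtain ⟨c, hc⟩ := htg a.2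
        show ((a : A') : E) ∈ Bimg
        rw [← hc]
        exact Algebra.subset_adjoin ⟨Sum.inr c, rfl⟩
      · exact hAB' (a : Aimg).2
    let fam : t ⊕ s → Bimg := fun i => ⟨_, hmemB i⟩
    have hfam : AlgebraicIndependent ℂ fam := AlgebraicIndependent.of_comp Bimg.val hsum
    have hle := hfam.cardinalMk_le_trdeg
    rw [Cardinal.mk_sum, Cardinal.lift_id, Cardinal.lift_id, htcard, hscard, htB, Nat.cast_add,
      add_comm (e : Cardinal)] at hle
    exact (Cardinal.add_le_add_iff_of_lt_aleph0 (Cardinal.natCast_lt_aleph0 (n := e))).1 hle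
  · /- (2) the specialisation criterion -/
    intro b₀ P₀ hP₀ hfb hGP hG'b d hdim
    haveI := hP₀
    -- `𝔭 ⊆ ker (aeval b₀)`: the evaluation `A → ℂ` at `b₀` and its kernel `m`
    have h𝔭b : ∀ g ∈ 𝔭, aeval b₀ g = 0 := by
      intro g hg
      rw [← hG'] at hg
      refine Submodule.span_induction (fun x hx => hG'b x hx) (map_zero _)
        (fun x y _ _ hx hy => by rw [map_add, hx, hy, add_zero])
        (fun a x _ hx => by rw [smul_eq_mul, map_mul, hx, mul_zero]) hg
    let evb : A →ₐ[ℂ] ℂ := Ideal.Quotient.liftₐ 𝔭 (aeval b₀) h𝔭b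
    have hevb_mk : ∀ g : A₀, evb (Ideal.Quotient.mk 𝔭 g) = aeval b₀ g := fun g => rfl
    have hevb : Function.Surjective evb := fun c =>
      ⟨Ideal.Quotient.mk 𝔭 (C c), by rw [hevb_mk, aeval_C]; rfl⟩
    set m : Ideal A := RingHom.ker evb.toRingHom with hm
    have hmmax : m.IsMaximal := RingHom.ker_isMaximal_of_surjective evb.toRingHom hevb
    have hfm : Ideal.Quotient.mk 𝔭 f₀ ∉ m := by
      rw [hm, RingHom.mem_ker]
      exact hfb
    -- the specialisations of `𝔔` lie in `P₀`
    have h𝔔P : ∀ g ∈ 𝔔, spec b₀ g ∈ P₀ := by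
      intro g hg
      rw [← hG] at hg
      refine Submodule.span_induction (fun x hx => hGP x hx) (by rw [map_zero]; exact P₀.zero_mem)
        (fun x y _ _ hx hy => by rw [map_add]; exact P₀.add_mem hx hy)
        (fun a x _ hx => by rw [smul_eq_mul, map_mul]; exact P₀.mul_mem_left _ hx) hg
    -- `Ψ : B → ℂ[w] ⧸ P₀` and the prime `𝔓 = ker Ψ ⊇ m B`
    let Ψ : B →ₐ[ℂ] MvPolynomial σ ℂ ⧸ P₀ :=
      Ideal.Quotient.liftₐ 𝔔 ((Ideal.Quotient.mkₐ ℂ P₀).comp (spec b₀)) fun g hg => by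
        rw [AlgHom.comp_apply, Ideal.Quotient.mkₐ_eq_mk, Ideal.Quotient.eq_zero_iff_mem]
        exact h𝔔P g hg
    have hΨ_mk : ∀ g : MvPolynomial (Fin p ⊕ σ) ℂ, Ψ (Ideal.Quotient.mk 𝔔 g) = Ideal.Quotient.mk P₀ (spec b₀ g) := fun g => rfl
    set 𝔓 : Ideal B := RingHom.ker Ψ.toRingHom with h𝔓
    haveI : 𝔓.IsPrime := RingHom.ker_isPrime _
    have hspecι₀ : ∀ g : A₀, spec (σ := σ) b₀ (ι₀ g) = C (aeval b₀ g) := by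
      intro g
      show aeval _ (rename Sum.inl g) = _
      rw [aeval_rename]
      have h1 : ((fun c => Sum.elim (fun l => C (b₀ l)) X c) ∘ Sum.inl : Fin p → MvPolynomial σ ℂ) =
          fun l => C (b₀ l) := by funext l; rfl
      rw [h1]
      have h2 : (aeval fun l => (C (b₀ l) : MvPolynomial σ ℂ)) =
          (IsScalarTower.toAlgHom ℂ ℂ (MvPolynomial σ ℂ)).comp (aeval b₀) := by
        refine MvPolynomial.algHom_ext fun l => ?_
        rw [aeval_X, AlgHom.comp_apply, aeval_X]
        rfl
      rw [h2, AlgHom.comp_apply]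
      rfl
    have hm𝔓 : m.map (algebraMap A B) ≤ 𝔓 := by
      rw [Ideal.map_le_iff_le_comap]
      intro a ha
      obtain ⟨g, rfl⟩ := Ideal.Quotient.mk_surjective a
      rw [hm, RingHom.mem_ker] at ha
      have ha' : aeval b₀ g = 0 := ha
      rw [Ideal.mem_comap, h𝔓, RingHom.mem_ker]
      show Ψ (φAB (Ideal.Quotient.mk 𝔭 g)) = 0
      show Ψ (Ideal.Quotient.mk 𝔔 (ι₀ g)) = 0
      rw [hΨ_mk, hspecι₀, ha', map_zero, map_zero]
    -- a minimal prime `𝔓₀ ⊆ 𝔓` over `m B`: `dim B ⧸ 𝔓₀ = r`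
    obtain ⟨𝔓₀, h𝔓₀min, h𝔓₀le⟩ := Ideal.exists_minimalPrimes_le hm𝔓
    haveI h𝔓₀p : 𝔓₀.IsPrime := h𝔓₀min.1.1
    have hm𝔓₀ : m.map (algebraMap A B) ≤ 𝔓₀ := h𝔓₀min.1.2
    have hr : ringKrullDim (B ⧸ 𝔓₀) = r := hfib m hmmax hfm 𝔓₀ h𝔓₀min
    -- `θ : ℂ[w] → B ⧸ 𝔓₀` is surjective, with kernel `𝔮₀ ⊆ P₀` containing the `φ(b₀, ·)`
    let ιB : MvPolynomial σ ℂ →ₐ[ℂ] B := (Ideal.Quotient.mkₐ ℂ 𝔔).comp (rename Sum.inr)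
    let θ : MvPolynomial σ ℂ →ₐ[ℂ] B ⧸ 𝔓₀ := (Ideal.Quotient.mkₐ ℂ 𝔓₀).comp ιB
    have hcong : ∀ g : MvPolynomial (Fin p ⊕ σ) ℂ, Ideal.Quotient.mk 𝔓₀ (Ideal.Quotient.mk 𝔔 g) = θ (spec b₀ g) := by
      intro g
      have : ((Ideal.Quotient.mkₐ ℂ 𝔓₀).comp (Ideal.Quotient.mkₐ ℂ 𝔔) : MvPolynomial (Fin p ⊕ σ) ℂ →ₐ[ℂ] B ⧸ 𝔓₀) =
          θ.comp (spec b₀) := by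
        refine MvPolynomial.algHom_ext fun c => ?_
        rcases c with l | c
        · -- `X̄_{inl l} ≡ b₀ l` modulo `m B ⊆ 𝔓₀`
          show Ideal.Quotient.mk 𝔓₀ (Ideal.Quotient.mk 𝔔 (X (Sum.inl l))) =
            Ideal.Quotient.mk 𝔓₀ (Ideal.Quotient.mk 𝔔 (rename Sum.inr (spec b₀ (X (Sum.inl l)))))
          rw [spec_X_inl, rename_C]
          have hmem : Ideal.Quotient.mk 𝔔 (X (Sum.inl l) - C (b₀ l) : MvPolynomial (Fin p ⊕ σ) ℂ) ∈ 𝔓₀ := by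
            have hxm : Ideal.Quotient.mk 𝔭 (X l - C (b₀ l)) ∈ m := by
              rw [hm, RingHom.mem_ker]
              show evb (Ideal.Quotient.mk 𝔭 (X l - C (b₀ l))) = 0
              rw [hevb_mk, map_sub, aeval_X, aeval_C]
              exact sub_self _
            have h := hm𝔓₀ (Ideal.mem_map_of_mem (algebraMap A B) hxm)
            have : (algebraMap A B) (Ideal.Quotient.mk 𝔭 (X l - C (b₀ l))) =
                Ideal.Quotient.mk 𝔔 (X (Sum.inl l) - C (b₀ l)) := by
              show φAB (Ideal.Quotient.mk 𝔭 (X l - C (b₀ l))) = _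
              show Ideal.Quotient.mk 𝔔 (ι₀ (X l - C (b₀ l))) = _
              congr 1
              show rename Sum.inl (X l - C (b₀ l)) = _
              rw [map_sub, rename_X, rename_C]
            rwa [this] at h
          rw [map_sub, ← Ideal.Quotient.mk_eq_mk_iff_sub_mem] at hmem
          rw [hmem]
        · show Ideal.Quotient.mk 𝔓₀ (Ideal.Quotient.mk 𝔔 (X (Sum.inr c))) =
            Ideal.Quotient.mk 𝔓₀ (Ideal.Quotient.mk 𝔔 (rename Sum.inr (spec b₀ (X (Sum.inr c)))))
          rw [spec_X_inr, rename_X]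
      exact congrArg (fun F : MvPolynomial (Fin p ⊕ σ) ℂ →ₐ[ℂ] B ⧸ 𝔓₀ => F g) this
    have hθsurj : Function.Surjective θ := by
      intro x
      obtain ⟨y, rfl⟩ := Ideal.Quotient.mk_surjective x
      obtain ⟨g, rfl⟩ := Ideal.Quotient.mk_surjective y
      exact ⟨spec b₀ g, (hcong g).symm⟩
    set 𝔮₀ : Ideal (MvPolynomial σ ℂ) := RingHom.ker θ.toRingHom with h𝔮₀
    haveI : IsDomain (B ⧸ 𝔓₀) := Ideal.Quotient.isDomain 𝔓₀
    haveI h𝔮₀p : 𝔮₀.IsPrime := RingHom.ker_isPrime _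
    -- `Ψ` factors through `B ⧸ 𝔓₀`; on `ℂ[w]` the composite with `θ` is the quotient map
    let Ψbar : B ⧸ 𝔓₀ →ₐ[ℂ] MvPolynomial σ ℂ ⧸ P₀ :=
      Ideal.Quotient.liftₐ 𝔓₀ Ψ fun x hx => h𝔓₀le hx
    have hΨθ : ∀ g : MvPolynomial σ ℂ, Ψbar (θ g) = Ideal.Quotient.mk P₀ g := by
      intro g
      show Ψ (Ideal.Quotient.mk 𝔔 (rename Sum.inr g)) = _
      rw [hΨ_mk]
      congr 1
      show aeval _ (rename Sum.inr g) = g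
      rw [aeval_rename]
      have : ((fun c => Sum.elim (fun l => C (b₀ l)) X c) ∘ Sum.inr : σ → MvPolynomial σ ℂ) = X := by
        funext c; rfl
      rw [this, aeval_X_left, AlgHom.id_apply]
    have h𝔮₀P : 𝔮₀ ≤ P₀ := by
      intro g hg
      rw [h𝔮₀, RingHom.mem_ker] at hg
      have hg' : θ g = 0 := hg
      rw [← Ideal.Quotient.eq_zero_iff_mem, ← hΨθ, hg', map_zero]
    have h𝔮₀Φ : ∀ φ ∈ Φ, spec b₀ φ ∈ 𝔮₀ := by
      intro φ hφ
      rw [h𝔮₀, RingHom.mem_ker]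
      show θ (spec b₀ φ) = 0
      rw [← hcong, Ideal.Quotient.eq_zero_iff_mem.2 (show φ ∈ 𝔔 from hΦ φ hφ), map_zero]
    -- `dim ℂ[w] ⧸ 𝔮₀ = dim B ⧸ 𝔓₀ = r`
    have hdimeq : ringKrullDim (MvPolynomial σ ℂ ⧸ 𝔮₀) = ringKrullDim (B ⧸ 𝔓₀) :=
      ringKrullDim_eq_of_ringEquiv (Ideal.quotientKerAlgEquivOfSurjective hθsurj).toRingEquiv
    have := hdim 𝔮₀ h𝔮₀p h𝔮₀P h𝔮₀Φ
    rw [hdimeq, hr] at this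
    exact_mod_cast this

end Literature.NumberTheory.Transcendental.WeakZP
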